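import Summits.AtomisticToContinuum.Crystallization.Theorems.FreeSplittingCertificatesStrictSplittingRuleTorusModelDualSum

/-!
# Block (congruence) certificates for sparse quadratic forms — infrastructure for the 6×6×3 torus model of H12⋆

Route `FreeSplittingCertificates`, crux `StrictSplittingRule` (stmt-AtomisticToContinuum-12560); unit b2b-freesplit-B (block 2b,
PART B, gen 2).  VALUE = certificate infrastructure for FINITE models — NOT summit progress; `stub_coreJointCoercive` is not proved.

The dense rounded-`LDLᵀ` certificate of `…TorusQForm.lean` (`certArrays` + `PSD.IsGramCertDD`, cost `~n³`) is out of reach of the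
evaluator for the 6×6×3 torus (`n = 648`).  The model is exactly invariant under the site group `D3h`, so in a symmetry-adapted basis
its matrix is block diagonal (blocks `65, 53, 121, 121, 37, 61, 95, 95`).  This file lets a certificate EXPLOIT such a structure
WITHOUT any representation theory inside Lean: the certifier supplies sparse functionals `r_a` (rows of a change of variables) and
small symmetric matrices `N_k`, and the term list `Σ_k Σ_{a,b} (N_k)_{ab} · r_a(u) · r_b(u)` (`blockTerms`); Lean checks
(1) that its assembled (symmetrised) Gram matrix EQUALS that of the model's term list (`evalQ_eq_of_symm_assemble_eq`: then the two
quadratic forms agree everywhere), and (2) a rounded Gram certificate `PSD.IsGramCertDD` of each `N_k` (`blockTerms_nonneg`).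
Also: decoders for sparse integer / rational functionals shipped as `List ℤ` rows, and an (untrusted) sparse evaluator
`sparseGram / blockGramArr` of `colᵀ M col'` used to PRODUCE the `N_k` inside Lean from basis columns.  This is the standard
symmetry reduction of invariant semidefinite certificates (K. Gatermann, P. Parrilo, *Symmetry groups, semidefinite programs, and sums
of squares*, J. Pure Appl. Algebra 192 (2004) 95–128, arXiv:math/0211450, §3), arranged so that the kernel only checks a polynomial
identity and small Gram certificates.  [folklore]
-/

namespace Summit.AtomisticToContinuum.Crystallization.Theorems.StrictSplittingRuleTorusLMI

open Literature.Computation.Certificates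

variable {N : ℕ}

/-! ## Equality of assembled Gram matrices transfers the quadratic form -/

/-- Two term lists with the same symmetrised Gram matrix define the same quadratic form. [folklore] -/
theorem evalQ_eq_of_symm_assemble_eq {ts ts' : List (Term N)}
    (h : symm (assemble ts).toMatrix = symm (assemble ts').toMatrix) (u : Fin N → ℚ) : evalQ ts u = evalQ ts' u := by
  rw [evalQ_eq_quadForm, evalQ_eq_quadForm, ← toMatrix_assemble ts, ← toMatrix_assemble ts',
    ← quadForm_symm (assemble ts).toMatrix u, h, quadForm_symm]

/-- **Congruence glue**: if the model's term list and a certificate term list assemble to the same symmetrised matrix and the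
certificate list is nonnegative everywhere, so is the model's form. [folklore] -/
theorem evalQ_nonneg_of_symm_assemble_eq {ts ts' : List (Term N)}
    (h : symm (assemble ts).toMatrix = symm (assemble ts').toMatrix) (h' : ∀ u, 0 ≤ evalQ ts' u) (u : Fin N → ℚ) :
    0 ≤ evalQ ts u := by
  rw [evalQ_eq_of_symm_assemble_eq h u]; exact h' u

/-! ## Block term lists `Σ_{a,b} N_{ab} · r_a(u) · r_b(u)` -/

/-- The term list `[(N a b, r a, r b) | a, b]`. [folklore] -/
def blockTerms {d : ℕ} (Nk : Matrix (Fin d) (Fin d) ℚ) (rows : Fin d → LinF N) : List (Term N) :=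
  (List.finRange d).flatMap fun a => (List.finRange d).map fun b => (Nk a b, rows a, rows b)

/-- `evalQ` of a mapped list. [folklore] -/
theorem evalQ_mapN {α : Type*} (l : List α) (g : α → Term N) (u : Fin N → ℚ) :
    evalQ (l.map g) u = (l.map fun a => (g a).1 * (g a).2.1.eval u * (g a).2.2.eval u).sum := by
  simp only [evalQ, List.map_map]; rfl

/-- **The block term list is the quadratic form of `N` in the variables `y_a = r_a(u)`.** [folklore] -/
theorem evalQ_blockTerms {d : ℕ} (Nk : Matrix (Fin d) (Fin d) ℚ) (rows : Fin d → LinF N) (u : Fin N → ℚ) :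
    evalQ (blockTerms Nk rows) u = ∑ a, ∑ b, (rows a).eval u * Nk a b * (rows b).eval u := by
  rw [blockTerms, evalQ_flatMapN, Fin.sum_univ_def]
  congr 1
  refine List.map_congr_left fun a _ => ?_
  rw [evalQ_mapN, Fin.sum_univ_def]
  congr 1
  refine List.map_congr_left fun b _ => ?_
  ring

/-- **A rounded Gram certificate of `N` makes the block term list nonnegative everywhere.** [folklore] -/
theorem blockTerms_nonneg {d m : ℕ} {Nk : Matrix (Fin d) (Fin d) ℚ} {dv : Fin m → ℚ} {F : Matrix (Fin m) (Fin d) ℚ}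
    (h : PSD.IsGramCertDD Nk dv F) (rows : Fin d → LinF N) (u : Fin N → ℚ) : 0 ≤ evalQ (blockTerms Nk rows) u := by
  rw [evalQ_blockTerms]
  have h0 := h.quadForm_nonneg (R := ℚ) (fun a => (rows a).eval u)
  simpa only [Rat.cast_id] using h0

/-- Nonnegativity is additive over concatenated term lists. [folklore] -/
theorem evalQ_append_nonneg {ts ts' : List (Term N)} (h : ∀ u, 0 ≤ evalQ ts u) (h' : ∀ u, 0 ≤ evalQ ts' u)
    (u : Fin N → ℚ) : 0 ≤ evalQ (ts ++ ts') u := by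
  rw [evalQ_append]; exact add_nonneg (h u) (h' u)

/-! ## Shipped sparse functionals and the (untrusted) production of the blocks inside Lean -/

/-- Decode a sparse INTEGER functional from a flat row `[i₁, v₁, i₂, v₂, …]`. [folklore] -/
def linFOfInts (n : ℕ) (hn : 0 < n) : List ℤ → LinF n
  | i :: v :: rest => (⟨i.toNat % n, Nat.mod_lt _ hn⟩, (v : ℚ)) :: linFOfInts n hn rest
  | _ => []

/-- Decode a sparse RATIONAL functional from a flat row `[i₁, p₁, q₁, i₂, p₂, q₂, …]` (`value = p/q`). [folklore] -/
def linFOfRats (n : ℕ) (hn : 0 < n) : List ℤ → LinF n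
  | i :: p :: q :: rest => (⟨i.toNat % n, Nat.mod_lt _ hn⟩, (p : ℚ) / (q : ℚ)) :: linFOfRats n hn rest
  | _ => []

/-- `colᵀ M col'` for sparse `col, col'` (cost `|col|·|col'|` entry reads). Untrusted producer. [folklore] -/
def sparseGram (M : Matrix (Fin N) (Fin N) ℚ) (ca cb : LinF N) : ℚ :=
  (ca.map fun p => p.2 * (cb.map fun q => M p.1 q.1 * q.2).sum).sum

/-- The `d × d` array `(col_{off+a}ᵀ M col_{off+b})_{a,b}` of one block of basis columns. Untrusted producer. [folklore] -/
def blockGramArr (M : Matrix (Fin N) (Fin N) ℚ) (cols : Array (LinF N)) (off d : ℕ) : Array (Array ℚ) :=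
  (Array.range d).map fun a => (Array.range d).map fun b => sparseGram M (cols.getD (off + a) []) (cols.getD (off + b) [])

/-- Rows `off … off+d−1` of an array of functionals as a `Fin d`-family. [folklore] -/
def rowsFrom (rs : Array (LinF N)) (off d : ℕ) : Fin d → LinF N := fun a => rs.getD (off + a.val) []

end Summit.AtomisticToContinuum.Crystallization.Theorems.StrictSplittingRuleTorusLMI
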